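import Summits.KontsevichZagierPeriods.KontsevichZagierPeriods.Theorems.RootDecompRationalCubeDichotomySimpleBranchPoleBox

/-!
# Route RootDecompRationalCubeDichotomy — item 27842 `PiRationalisationSimpleBranch` PROVED, part 3/11 (`RootDecompRationalCubeDichotomySimpleBranchRootIso`)

Theorems-split (≤ 400 lines each, sequential imports) of the decomp-kz lens-2 gen-4 file
`run/shared/lean/pub/decomp-kz/decomp-kz-lens-2/g4/PiRationalisationSimpleBranch27842.lean` (2963 lines; lens farm rc 0, writer re-check
rc 0 audit proof-of-item closed:true, critic g2 by-name probe std axioms, 2026-08-30T05:27:57Z/06:02:52Z). The rung: for simple-branch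
Nash data (`F(x,g) = 0`, `∂_z F(x,g) ≠ 0` on the closed cube) `[π]^K·[s] ∈ relations ⊔ ⟨rational closed-cube sector⟩` for all `K ≥ 1` —
root isolation on rational sub-boxes, the Green band move (planar Stokes inside the four moves), the half winding number ≡ 4[A] ≡ [π],
box rescaling, and `PiTimesSector` (item 26388, landed). The final part closes the ROUTE ITEM by name
(`piRationalisationSimpleBranch_proof`). Sector lemmas are REUSED from the landed rung-24903 file `…PiRationalisationSqrtMoves`.
[Kontsevich–Zagier 2001 §1.2; argument principle] Standard axioms, 0 sorry.
-/

noncomputable section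

set_option linter.dupNamespace false

/-! ## v4: ROOT ISOLATION KIT (divided difference + uniform isolation), from `g4/scratch/RootIsolationKit.lean` -/

namespace Summit.KontsevichZagierPeriods.RootDecompRationalCubeDichotomy.Rung27842.RootIso

open MvPolynomial Set

variable {n : ℕ}

/-- **Divided difference.** `F(x,z) − F(x,y) = (z − y)·K(x,y,z)` and `K(x,y,y) = (∂_z F)(x,y)`, in every commutative
ℚ-algebra. Coordinates of `Fin (n+2)`: `x` at `castSucc ∘ castSucc`, `y` at `castSucc last`, `z` at `last`. -/
theorem exists_divDiff (F : MvPolynomial (Fin (n + 1)) ℚ) :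
    ∃ K : MvPolynomial (Fin (n + 2)) ℚ,
      (∀ {A : Type} [CommRing A] [Algebra ℚ A] (x : Fin n → A) (y z : A),
        aeval (Fin.snoc x z : Fin (n + 1) → A) F - aeval (Fin.snoc x y : Fin (n + 1) → A) F =
          (z - y) * aeval (Fin.snoc (Fin.snoc x y : Fin (n + 1) → A) z : Fin (n + 2) → A) K) ∧
      (∀ {A : Type} [CommRing A] [Algebra ℚ A] (x : Fin n → A) (y : A),
        aeval (Fin.snoc (Fin.snoc x y : Fin (n + 1) → A) y : Fin (n + 2) → A) K =
          aeval (Fin.snoc x y : Fin (n + 1) → A) (pderiv (Fin.last n) F)) := by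
  induction F using MvPolynomial.induction_on with
  | C a => exact ⟨0, fun x y z => by simp, fun x y => by simp⟩
  | add p q hp hq =>
    obtain ⟨Kp, hp1, hp2⟩ := hp
    obtain ⟨Kq, hq1, hq2⟩ := hq
    refine ⟨Kp + Kq, fun x y z => ?_, fun x y => ?_⟩
    · simp only [map_add]
      rw [mul_add, ← hp1, ← hq1]; ring
    · simp only [map_add, hp2, hq2]
  | mul_X p i hp =>
    obtain ⟨Kp, hp1, hp2⟩ := hp
    have hcomp : ∀ {A : Type} (x : Fin n → A) (y z : A),
        ((Fin.snoc (Fin.snoc x y : Fin (n + 1) → A) z : Fin (n + 2) → A) ∘ Fin.castSucc) =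
          (Fin.snoc x y : Fin (n + 1) → A) := by
      intro A x y z; funext k; simp
    rcases Fin.eq_castSucc_or_eq_last i with ⟨j, rfl⟩ | rfl
    · refine ⟨Kp * X (Fin.castSucc (Fin.castSucc j)), fun x y z => ?_, fun x y => ?_⟩
      · simp only [map_mul, aeval_X, Fin.snoc_castSucc]
        calc aeval (Fin.snoc x z : Fin (n + 1) → _) p * x j - aeval (Fin.snoc x y : Fin (n + 1) → _) p * x j
            = (aeval (Fin.snoc x z : Fin (n + 1) → _) p - aeval (Fin.snoc x y : Fin (n + 1) → _) p) * x j := by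
              ring
          _ = _ := by rw [hp1 x y z]; ring
      · simp [pderiv_X_of_ne (Fin.castSucc_lt_last j).ne, hp2]; ring
    · refine ⟨Kp * X (Fin.last (n + 1)) + rename Fin.castSucc p, fun x y z => ?_, fun x y => ?_⟩
      · simp only [map_mul, map_add, aeval_X, Fin.snoc_last, aeval_rename, hcomp]
        calc aeval (Fin.snoc x z : Fin (n + 1) → _) p * z - aeval (Fin.snoc x y : Fin (n + 1) → _) p * y
            = (aeval (Fin.snoc x z : Fin (n + 1) → _) p - aeval (Fin.snoc x y : Fin (n + 1) → _) p) * z +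
                aeval (Fin.snoc x y : Fin (n + 1) → _) p * (z - y) := by ring
          _ = _ := by rw [hp1 x y z]; ring
      · simp only [map_mul, map_add, aeval_X, Fin.snoc_last, aeval_rename, hcomp, hp2, Derivation.leibniz,
          pderiv_X_self, smul_eq_mul, mul_one]
        ring

/-- `aeval` over `ℂ` at a real point is the real `aeval`, coerced. [folklore] -/
theorem aeval_ofReal_comp {m : ℕ} (w : Fin m → ℝ) (P : MvPolynomial (Fin m) ℚ) :
    aeval (fun i => ((w i : ℝ) : ℂ)) P = ((aeval w P : ℝ) : ℂ) := by
  have h : (aeval (fun i => ((w i : ℝ) : ℂ)) : MvPolynomial (Fin m) ℚ →ₐ[ℚ] ℂ).toRingHom =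
      (algebraMap ℝ ℂ).comp (aeval w : MvPolynomial (Fin m) ℚ →ₐ[ℚ] ℝ).toRingHom := by
    refine MvPolynomial.ringHom_ext (fun r => ?_) (fun i => ?_)
    · simp [eq_ratCast]
    · simp
  exact RingHom.congr_fun h P

/-- The complex point `(x, z)` over a real base point. -/
def cpt (x : Fin n → ℝ) (z : ℂ) : Fin (n + 1) → ℂ := Fin.snoc (fun i => ((x i : ℝ) : ℂ)) z

/-- Auxiliary step `cpt_ofReal`. [bookkeeping] -/
theorem cpt_ofReal (x : Fin n → ℝ) (t : ℝ) : cpt x (t : ℂ) = fun i => ((Fin.snoc x t : Fin (n + 1) → ℝ) i : ℂ) := by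
  funext i
  refine Fin.lastCases ?_ (fun j => ?_) i
  · simp [cpt]
  · simp [cpt]

/-- **Uniform root isolation of a simple real branch over the closed cube.** [folklore] -/
theorem uniform_root_isolation {U : Set (Fin n → ℝ)} (hU : IsOpen U)
    (hcU : Set.pi Set.univ (fun _ : Fin n => Icc (0:ℝ) 1) ⊆ U)
    (g : (Fin n → ℝ) → ℝ) (hg : ContinuousOn g U) (F : MvPolynomial (Fin (n + 1)) ℚ)
    (hF0 : ∀ x ∈ Set.pi Set.univ (fun _ : Fin n => Icc (0:ℝ) 1), aeval (Fin.snoc x (g x) : Fin (n + 1) → ℝ) F = 0)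
    (hFz : ∀ x ∈ Set.pi Set.univ (fun _ : Fin n => Icc (0:ℝ) 1),
      aeval (Fin.snoc x (g x) : Fin (n + 1) → ℝ) (pderiv (Fin.last n) F) ≠ 0) :
    ∃ δ > 0, ∀ x ∈ Set.pi Set.univ (fun _ : Fin n => Icc (0:ℝ) 1), ∀ z : ℂ,
      z ≠ ((g x : ℝ) : ℂ) → ‖z - ((g x : ℝ) : ℂ)‖ ≤ δ → aeval (cpt x z) F ≠ 0 := by
  set cube : Set (Fin n → ℝ) := Set.pi Set.univ (fun _ : Fin n => Icc (0:ℝ) 1) with hcube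
  obtain ⟨K, hK1, hK2⟩ := exists_divDiff F
  -- the continuous function `(x, z) ↦ K(x, g x, z)` on `U × ℂ`
  let Φ : (Fin n → ℝ) × ℂ → ℂ := fun p =>
    aeval (Fin.snoc (Fin.snoc (fun i => ((p.1 i : ℝ) : ℂ)) ((g p.1 : ℝ) : ℂ) : Fin (n + 1) → ℂ) p.2 : Fin (n + 2) → ℂ) K
  have hΦ : ContinuousOn Φ (U ×ˢ univ) := by
    have hc : Continuous (fun w : Fin (n + 2) → ℂ => aeval w K) := by
      have := MvPolynomial.continuous_eval (MvPolynomial.map (algebraMap ℚ ℂ) K)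
      simpa only [MvPolynomial.eval_map, ← MvPolynomial.aeval_def] using this
    refine hc.comp_continuousOn ?_
    refine continuousOn_pi.2 fun k => ?_
    refine Fin.lastCases ?_ (fun k' => ?_) k
    · simp only [Fin.snoc_last]; exact continuous_snd.continuousOn
    · simp only [Fin.snoc_castSucc]
      refine Fin.lastCases ?_ (fun j => ?_) k'
      · simp only [Fin.snoc_last]
        exact (Complex.continuous_ofReal.comp_continuousOn (hg.comp continuous_fst.continuousOn
          (fun p hp => hp.1)))
      · simp only [Fin.snoc_castSucc]
        exact (Complex.continuous_ofReal.comp ((continuous_apply j).comp continuous_fst)).continuousOn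
  -- the open set where `Φ ≠ 0`
  have ht : IsOpen ((U ×ˢ (univ : Set ℂ)) ∩ Φ ⁻¹' {w | w ≠ 0}) :=
    hΦ.isOpen_inter_preimage (hU.prod isOpen_univ) isOpen_ne
  -- the compact graph
  have hcubec : IsCompact cube := isCompact_univ_pi fun _ => isCompact_Icc
  let γ : (Fin n → ℝ) → (Fin n → ℝ) × ℂ := fun x => (x, ((g x : ℝ) : ℂ))
  have hγ : ContinuousOn γ cube :=
    continuousOn_id.prodMk (Complex.continuous_ofReal.comp_continuousOn (hg.mono hcU))
  have hΓ : IsCompact (γ '' cube) := hcubec.image_of_continuousOn hγ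
  have hΓt : γ '' cube ⊆ (U ×ˢ (univ : Set ℂ)) ∩ Φ ⁻¹' {w | w ≠ 0} := by
    rintro _ ⟨x, hx, rfl⟩
    refine ⟨⟨hcU hx, mem_univ _⟩, ?_⟩
    show Φ (x, ((g x : ℝ) : ℂ)) ≠ 0
    have h1 : Φ (x, ((g x : ℝ) : ℂ)) = aeval (Fin.snoc (fun i => ((x i : ℝ) : ℂ)) ((g x : ℝ) : ℂ) : Fin (n + 1) → ℂ)
        (pderiv (Fin.last n) F) := hK2 _ _
    rw [h1]
    have h2 : (Fin.snoc (fun i => ((x i : ℝ) : ℂ)) ((g x : ℝ) : ℂ) : Fin (n + 1) → ℂ) =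
        fun i => ((Fin.snoc x (g x) : Fin (n + 1) → ℝ) i : ℂ) := cpt_ofReal x (g x)
    rw [h2, aeval_ofReal_comp]
    exact_mod_cast hFz x hx
  obtain ⟨δ, hδ, hsub⟩ := hΓ.exists_cthickening_subset_open ht hΓt
  refine ⟨δ, hδ, fun x hx z hz hdist => ?_⟩
  -- `(x, z)` lies in the `δ`-thickening of the graph
  have hmem : (x, z) ∈ Metric.cthickening δ (γ '' cube) := by
    refine Metric.mem_cthickening_of_dist_le (x, z) (γ x) δ _ (mem_image_of_mem γ hx) ?_
    rw [Prod.dist_eq, dist_self]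
    simpa [dist_eq_norm] using hdist
  have hne : Φ (x, z) ≠ 0 := (hsub hmem).2
  -- `F(x,z) = F(x,z) − F(x,g x) = (z − g x)·Φ(x,z)`
  have h0 : aeval (cpt x ((g x : ℝ) : ℂ)) F = 0 := by
    rw [cpt_ofReal, aeval_ofReal_comp, hF0 x hx]; simp
  have hid := hK1 (fun i => ((x i : ℝ) : ℂ)) ((g x : ℝ) : ℂ) z
  intro hFz0
  have : (z - ((g x : ℝ) : ℂ)) * Φ (x, z) = 0 := by
    rw [← hid]; change aeval (cpt x z) F - aeval (cpt x ((g x : ℝ) : ℂ)) F = 0; rw [hFz0, h0, sub_zero]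
  rcases mul_eq_zero.1 this with h | h
  · exact hz (sub_eq_zero.1 h)
  · exact hne h

end Summit.KontsevichZagierPeriods.RootDecompRationalCubeDichotomy.Rung27842.RootIso

set_option linter.dupNamespace false

namespace Summit.KontsevichZagierPeriods.RootDecompRationalCubeDichotomy.Rung27842.ReIm

open MvPolynomial QuadraticAlgebra

variable {n : ℕ}

/-- `ℚ[x,u,v][i]` with `i² = −1`. -/
abbrev K (n : ℕ) : Type := QuadraticAlgebra (MvPolynomial (Fin (n + 2)) ℚ) (-1) 0

/-- The substitution `xᵢ ↦ xᵢ`, `z ↦ u + iv` into `ℚ[x,u,v][i]` (coordinates of `Fin (n+2)`: `x` at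
`castSucc (castSucc i)`, `u` at `castSucc (last n)`, `v` at `last (n+1)` — the layout of `Fin.snoc (Fin.snoc x u) v`). -/
def cplxSubst (n : ℕ) : Fin (n + 1) → K n :=
  Fin.snoc (fun i : Fin n => algebraMap (MvPolynomial (Fin (n + 2)) ℚ) (K n) (X (Fin.castSucc (Fin.castSucc i))))
    ⟨X (Fin.castSucc (Fin.last n)), X (Fin.last (n + 1))⟩

/-- `F(x, u+iv)` as an element of `ℚ[x,u,v][i]`. -/
def cplx (F : MvPolynomial (Fin (n + 1)) ℚ) : K n := aeval (cplxSubst n) F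

/-- The real part polynomial `Re F(x, u+iv) ∈ ℚ[x,u,v]`. -/
def reP (F : MvPolynomial (Fin (n + 1)) ℚ) : MvPolynomial (Fin (n + 2)) ℚ := (cplx F).re

/-- The imaginary part polynomial `Im F(x, u+iv) ∈ ℚ[x,u,v]`. -/
def imP (F : MvPolynomial (Fin (n + 1)) ℚ) : MvPolynomial (Fin (n + 2)) ℚ := (cplx F).im

/-- The complex point `(x, u + iv)` attached to a real point `w = (x, u, v)`. -/
def cplxPoint (w : Fin (n + 2) → ℝ) : Fin (n + 1) → ℂ :=
  Fin.snoc (fun i : Fin n => ((w (Fin.castSucc (Fin.castSucc i)) : ℝ) : ℂ))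
    (((w (Fin.castSucc (Fin.last n)) : ℝ) : ℂ) + ((w (Fin.last (n + 1)) : ℝ) : ℂ) * Complex.I)

/-- Evaluation of `ℚ[x,u,v][i]` at a real point `w`, into `ℂ`. -/
def evalK (w : Fin (n + 2) → ℝ) (q : K n) : ℂ :=
  ((aeval w q.re : ℝ) : ℂ) + ((aeval w q.im : ℝ) : ℂ) * Complex.I

/-- `evalK w` is a ring homomorphism. -/
def evalKHom (w : Fin (n + 2) → ℝ) : K n →+* ℂ where
  toFun := evalK w
  map_one' := by
    change ((aeval w (1 : MvPolynomial (Fin (n + 2)) ℚ) : ℝ) : ℂ) +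
      ((aeval w (0 : MvPolynomial (Fin (n + 2)) ℚ) : ℝ) : ℂ) * Complex.I = 1
    simp
  map_mul' q r := by
    apply Complex.ext
    all_goals (simp [evalK, QuadraticAlgebra.re_mul, QuadraticAlgebra.im_mul]; try ring)
  map_zero' := by
    change ((aeval w (0 : MvPolynomial (Fin (n + 2)) ℚ) : ℝ) : ℂ) +
      ((aeval w (0 : MvPolynomial (Fin (n + 2)) ℚ) : ℝ) : ℂ) * Complex.I = 0
    simp
  map_add' q r := by
    apply Complex.ext
    all_goals (simp [evalK]; try ring)

/-- **Compatibility**: evaluating `F(x, u+iv)` in `ℚ[x,u,v][i]` and then at the real point `w` gives the complex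
value `F(cplxPoint w)`. -/
theorem evalK_cplx (w : Fin (n + 2) → ℝ) (F : MvPolynomial (Fin (n + 1)) ℚ) :
    evalK w (cplx F) = aeval (cplxPoint w) F := by
  have h : ((evalKHom w).comp (aeval (cplxSubst n) : MvPolynomial (Fin (n + 1)) ℚ →ₐ[ℚ] K n).toRingHom) =
      (aeval (cplxPoint w) : MvPolynomial (Fin (n + 1)) ℚ →ₐ[ℚ] ℂ).toRingHom := by
    refine MvPolynomial.ringHom_ext (fun r => ?_) (fun i => ?_)
    · simp only [RingHom.coe_comp, AlgHom.toRingHom_eq_coe, RingHom.coe_coe, Function.comp_apply, aeval_C,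
        show ∀ q, evalKHom w q = evalK w q from fun _ => rfl, evalK]
      change ((aeval w (C r : MvPolynomial (Fin (n + 2)) ℚ) : ℝ) : ℂ) +
        ((aeval w (0 : MvPolynomial (Fin (n + 2)) ℚ) : ℝ) : ℂ) * Complex.I = algebraMap ℚ ℂ r
      simp [eq_ratCast]
    · simp only [RingHom.coe_comp, AlgHom.toRingHom_eq_coe, RingHom.coe_coe, Function.comp_apply, aeval_X,
        show ∀ q, evalKHom w q = evalK w q from fun _ => rfl, evalK]
      refine Fin.lastCases ?_ (fun j => ?_) i
      · simp [cplxSubst, cplxPoint]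
      · apply Complex.ext
        · simp [cplxSubst, cplxPoint, QuadraticAlgebra.algebraMap_eq]
        · simp [cplxSubst, cplxPoint, QuadraticAlgebra.algebraMap_eq]
  exact RingHom.congr_fun h F

/-- `Re F(x, u+iv) = (reP F)(x,u,v)`. -/
theorem re_aeval_cplxPoint (w : Fin (n + 2) → ℝ) (F : MvPolynomial (Fin (n + 1)) ℚ) :
    (aeval (cplxPoint w) F).re = aeval w (reP F) := by
  rw [← evalK_cplx]; simp [evalK, reP]

/-- `Im F(x, u+iv) = (imP F)(x,u,v)`. -/
theorem im_aeval_cplxPoint (w : Fin (n + 2) → ℝ) (F : MvPolynomial (Fin (n + 1)) ℚ) :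
    (aeval (cplxPoint w) F).im = aeval w (imP F) := by
  rw [← evalK_cplx]; simp [evalK, imP]

/-- `|F(x,u+iv)|² = reP² + imP²` as a ℚ-polynomial identity at real points. -/
theorem normSq_aeval_cplxPoint (w : Fin (n + 2) → ℝ) (F : MvPolynomial (Fin (n + 1)) ℚ) :
    Complex.normSq (aeval (cplxPoint w) F) = aeval w (reP F ^ 2 + imP F ^ 2) := by
  rw [Complex.normSq_apply, re_aeval_cplxPoint, im_aeval_cplxPoint]
  simp [sq]

/-- The point `cplxPoint (x, u, v)` is `(x, u + iv)` in `Fin.snoc` form. -/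
theorem cplxPoint_snoc_snoc (x : Fin n → ℝ) (u v : ℝ) :
    cplxPoint (Fin.snoc (Fin.snoc x u : Fin (n + 1) → ℝ) v) =
      (Fin.snoc (fun i => ((x i : ℝ) : ℂ)) ((u : ℂ) + (v : ℂ) * Complex.I) : Fin (n + 1) → ℂ) := by
  ext i
  refine Fin.lastCases ?_ (fun j => ?_) i
  · simp [cplxPoint]
  · simp [cplxPoint]

end Summit.KontsevichZagierPeriods.RootDecompRationalCubeDichotomy.Rung27842.ReIm
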